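import Literature.Barriers.AtomisticToContinuum.AnticontinuumLocalizationDecorrelation
import Mathlib.MeasureTheory.Integral.IntervalIntegral.FundThmCalculus
import Mathlib.Analysis.SpecialFunctions.Exp
import HarnessLib

/-!
# Narrowed barrier `AnticontinuumLocalizationNarrow` (barrier audit of `AnticontinuumLocalization`, 2026-08-15)

`Literature/Barriers/AtomisticToContinuum/` (D-0021 barrier catalogue), sub-problem `FouriersLaw`.
Companion of `AnticontinuumLocalization.lean`, whose BARRIER block rides on the named fact
`DeRoeckHuveneers2015_thm2` (W. De Roeck, F. Huveneers, *Asymptotic localization of energy in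
nondisordered oscillator chains*, CPAM **68** (2015), arXiv:1305.5127, Theorem 2 for the rotor
chain: on every polynomial time window `[0, ε^{-n}t]` the finite-time Green–Kubo conductivity is
`o(ε^m)`, `1 ≤ m < n`). The audit (refuter, 2026-08-15) found the vendored theorems faithful and the
scope caveats honest, but the catalogued `technique_class`/`blocks` wording broader than what the
printed theorems quantify over, in one formalisable respect: the theorems constrain POLYNOMIAL TIME
WINDOWS only, whereas the block lists "anti-continuum / weak-coupling expansions `κ = ∑ κ_k ε^k`" —
expansions and lower bounds of the INFINITE-time conductivity — as blocked ("every order is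
transport-free"). The source itself separates the two ("To establish this rigorously, one would
need to exchange the limits `t → ∞` and `ε → 0`", §2.3). This file records the sharpened barrier
`AnticontinuumLocalizationNarrow` with all conjuncts PROVED (`AnticontinuumLocalizationNarrow_holds`):

1. TRUST BASE. `DeRoeckHuveneers2015_thm1 → DeRoeckHuveneers2015_thm2`: the barrier fact follows from
   Theorem 1 of the source alone (`DeRoeckHuveneers2015_thm2_of_thm1_alone`,
   `AnticontinuumLocalizationDecorrelation.lean`: the §7 derivation with stationarity of the Gibbs
   state and the decorrelation inequality (7.1) proved in the tree).
2. SCHEMA (the gap, general form). For the window functional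
   `k_C(τ) = (2/τ)∫₀^τ (τ - s) C(s) ds` of an autocovariance function `C` — equal to
   `τ⁻¹ Var ∫₀^τ J` for every stationary square-integrable current `J` with
   `Cov(J_s, J_u) = C(|s - u|)` (folklore; here only the integration-by-parts form
   `k_C(τ) = (2/τ)∫₀^τ K(s) ds`, `K(s) = ∫₀^s C`, is proved, `gkWindow_eq_cesaro`), and exactly the
   quantity `T⁻²⟨(ε τ^{-1/2}∫₀^τ 𝒥_N(X^s_ε) ds)²⟩_T` of Theorem 2 once `N → ∞` is taken — EVERY family
   `C_ε` with `sup_{s ≥ 0} |C_ε(s)| ≤ B(ε)`, `B(ε) = O(ε^∞)`, satisfies Theorem 2's triple-limit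
   conclusion at EVERY pair of orders `(m, n)` (`polyWindow_vanishing_of_supSmall`:
   `|k_{C_ε}(τ)| ≤ 2B(ε)τ`, `abs_gkWindow_le`), whatever the value of its Green–Kubo integral
   `2∫₀^∞ C_ε`.
3. INSTANCE. The exponential (Ornstein–Uhlenbeck) autocovariances `C_ε(s) = (λ_ε/2)e^{-λ_ε s}` with
   rate `λ_ε = e^{-1/ε}` (`expCov`, `slowRate`) satisfy the schema's hypotheses
   (`abs_expCov_slowRate_le`, `tendsto_rpow_neg_mul_slowRate_half`), hence Theorem 2's conclusion for
   all `(m, n)` (`polyWindow_vanishing`), while `k_{C_ε}(τ) = 1 - (1 - e^{-λ_ετ})/(λ_ετ) → 1` as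
   `τ → ∞` for EVERY `ε` (`gkWindow_expCov`, `tendsto_gkWindow_expCov`): a current passing every
   finite-window test of the paper, at all orders, with unit conductivity.

Consequently no statement of Theorem 2's shape — at any set of orders `(m, n)` — implies
`κ(T, ε) = O(ε^m)`, `κ → 0`, or even `κ < 1`; what the barrier blocks is reading transport off a
polynomial window, not the positivity (or an `ε`-power lower bound) of the infinite-time
conductivity. The BARRIER block below restates `technique_class`/`blocks` accordingly and records the
evasions and non-evasions found in the literature read for the audit (page/section hits in the
block): the authors' review [DeRoeckHuveneers2019] (mobile chaotic spots, rate
`γ ∼ g^{1/2}e^{-c(log βg)²}`; numerical power-law fits and why they are not evasions — a literal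
power law for the `L²` relaxation time contradicts Theorem 4), Huveneers' review [Huveneers2017]
(heuristic LOWER bound `κ(T) ∼ g e^{-C(log(√(UT)/J))²}`), the noisy weak-coupling expansion
[BernardinHuveneersLebowitzLiveraniOlla2015] (`κ₂(λ) > 0` for the rotor chain with noise `λ > 0`;
`lim_{λ→0} κ₂(λ) = 0` undecided), and Arnold diffusion on lattices [GiulianiGuardia2023]
(transfer-of-energy orbits for A PRIORI UNSTABLE pendulum lattices; open for a priori stable ones
such as weakly coupled rotators).

## Design notes

* The schema is stated for autocovariance FUNCTIONS, not for processes or flows: it isolates the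
  purely analytic content of "Theorem 2's limit order sees only times `≤ ε^{-n}t`". The window
  functional is linear in `C`, so a current whose autocovariance splits into a part obeying
  Theorem 2 and a uniformly `O(ε^∞)` slow part still obeys Theorem 2, with the slow part's integral
  added to its conductivity.
* Conjunct (2) carries `|k|` inside `ENNReal.ofReal` (signed `C` allowed); for the instance `k ≥ 0`
  (`gkWindow_expCov_bounds`) and the absolute value is removed (`polyWindow_vanishing`), giving
  literally the shape of `DeRoeckHuveneers2015_thm2`'s conclusion (without the `N`-limsup, there
  being no `N`).
* Elementary inequalities used: `1 - x ≤ e^{-x} ≤ (1 + x)⁻¹ ≤ 1 - x + x²` (`x ≥ 0`), giving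
  `0 ≤ 1 - (1 - e^{-x})/x ≤ x` and `1 - x⁻¹ ≤ 1 - (1 - e^{-x})/x ≤ 1`; and `x^k e^{-x} → 0`
  (`Real.tendsto_pow_mul_exp_neg_atTop_nhds_zero`) at `x = ε⁻¹`.
* No named fact is introduced: `AnticontinuumLocalizationNarrow` is a `def … : Prop` proved in this
  file; `DeRoeckHuveneers2015_thm2_of_narrow` recovers the catalogued fact from it and Theorem 1.
-/

noncomputable section

open MeasureTheory Filter Topology Set
open scoped ENNReal

namespace Literature.Barriers.AtomisticToContinuum

namespace HeatConduction.OUCurrent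

/-- The finite-time (window) Green–Kubo functional of an autocovariance function `C`:
`k_C(τ) = (2/τ) ∫₀^τ (τ - s) C(s) ds`, which is `τ⁻¹ Var(∫₀^τ J)` for a stationary square-integrable
current `J` with autocovariance `C`. [folklore] -/
def gkWindow (C : ℝ → ℝ) (τ : ℝ) : ℝ :=
  2 / τ * ∫ s in (0 : ℝ)..τ, (τ - s) * C s

/-- The exponential autocovariance `C_λ(s) = (λ/2) e^{-λ s}` (Ornstein–Uhlenbeck current with rate
`λ`, normalised so that the Green–Kubo integral `2∫₀^∞ C_λ = 1`). [folklore] -/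
def expCov (lam s : ℝ) : ℝ :=
  lam / 2 * Real.exp (-(lam * s))

/-- The slow rates `λ_ε = e^{-1/ε}` (correlation time `e^{1/ε}`, beyond every polynomial window
`ε^{-n}`). [folklore] -/
def slowRate (ε : ℝ) : ℝ :=
  Real.exp (-ε⁻¹)

/-- The slow rates are positive. [folklore] -/
theorem slowRate_pos (ε : ℝ) : 0 < slowRate ε := Real.exp_pos _

/-- `∫₀^τ (τ - s) C_λ(s) ds = τ/2 - (1 - e^{-λτ})/(2λ)`. [folklore] -/
theorem integral_weight_expCov {lam : ℝ} (hlam : lam ≠ 0) (τ : ℝ) :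
    ∫ s in (0 : ℝ)..τ, (τ - s) * expCov lam s =
      τ / 2 - (1 - Real.exp (-(lam * τ))) / (2 * lam) := by
  set F : ℝ → ℝ := fun s => -((τ - s) * Real.exp (-(lam * s))) / 2 + Real.exp (-(lam * s)) / (2 * lam)
    with hF
  have hderiv : ∀ s : ℝ, HasDerivAt F ((τ - s) * expCov lam s) s := by
    intro s
    have hE : HasDerivAt (fun s : ℝ => Real.exp (-(lam * s))) (Real.exp (-(lam * s)) * -(lam * 1)) s :=
      (((hasDerivAt_id s).const_mul lam).neg).exp
    have hA : HasDerivAt (fun s : ℝ => (τ - s) * Real.exp (-(lam * s)))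
        ((-1) * Real.exp (-(lam * s)) + (τ - s) * (Real.exp (-(lam * s)) * -(lam * 1))) s :=
      ((hasDerivAt_id s).const_sub τ).mul hE
    have h := (hA.neg.div_const 2).add (hE.div_const (2 * lam))
    refine h.congr_deriv ?_
    simp only [expCov]
    field_simp
    ring
  have hint : IntervalIntegrable (fun s => (τ - s) * expCov lam s) volume 0 τ := by
    apply Continuous.intervalIntegrable
    unfold expCov
    fun_prop
  rw [intervalIntegral.integral_eq_sub_of_hasDerivAt (fun s _ => hderiv s) hint]
  simp only [hF, sub_zero, mul_zero, neg_zero, Real.exp_zero, sub_self, zero_mul, neg_zero, zero_div,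
    zero_add, mul_one]
  field_simp
  ring

/-- Closed form of the window functional of the exponential autocovariance:
`k_{C_λ}(τ) = 1 - (1 - e^{-λτ})/(λτ)`. [folklore] -/
theorem gkWindow_expCov {lam τ : ℝ} (hlam : lam ≠ 0) (hτ : τ ≠ 0) :
    gkWindow (expCov lam) τ = 1 - (1 - Real.exp (-(lam * τ))) / (lam * τ) := by
  rw [gkWindow, integral_weight_expCov hlam]
  field_simp

/-- The window functional is twice the Cesàro mean of the running Green–Kubo integral
`K(s) = ∫₀^s C`: `k_C(τ) = (2/τ) ∫₀^τ K(s) ds` (integration by parts; the textbook form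
"finite-time conductivity → 2∫₀^∞ C"). [folklore] -/
theorem gkWindow_eq_cesaro {C : ℝ → ℝ} (hC : Continuous C) (τ : ℝ) :
    gkWindow C τ = 2 / τ * ∫ s in (0 : ℝ)..τ, (∫ v in (0 : ℝ)..s, C v) := by
  unfold gkWindow
  congr 1
  have hK : ∀ s : ℝ, HasDerivAt (fun s => ∫ v in (0 : ℝ)..s, C v) (C s) s := fun s =>
    intervalIntegral.integral_hasDerivAt_right (hC.intervalIntegrable _ _)
      hC.aestronglyMeasurable.stronglyMeasurableAtFilter hC.continuousAt
  have hV : ∀ s : ℝ, HasDerivAt (fun s : ℝ => s - τ) 1 s := fun s =>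
    (hasDerivAt_id' s).sub_const τ
  have hibp := intervalIntegral.integral_mul_deriv_eq_deriv_mul (a := 0) (b := τ)
    (u := fun s => ∫ v in (0 : ℝ)..s, C v) (v := fun s : ℝ => s - τ) (u' := C) (v' := fun _ => 1)
    (fun s _ => hK s) (fun s _ => hV s) (hC.intervalIntegrable _ _)
    ((continuous_const : Continuous fun _ : ℝ => (1 : ℝ)).intervalIntegrable _ _)
  simp only [mul_one, sub_self, mul_zero, intervalIntegral.integral_same, zero_mul,
    zero_sub] at hibp
  rw [hibp, ← intervalIntegral.integral_neg]
  congr 1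
  funext s
  ring

/-- Elementary: for `x > 0`, `0 ≤ 1 - (1 - e^{-x})/x`. [folklore] -/
theorem kClosed_nonneg {x : ℝ} (hx : 0 < x) : 0 ≤ 1 - (1 - Real.exp (-x)) / x := by
  have h1 : -x + 1 ≤ Real.exp (-x) := Real.add_one_le_exp (-x)
  have h2 : (1 - Real.exp (-x)) / x ≤ 1 := by
    rw [div_le_one hx]
    linarith
  linarith

/-- Elementary: for `x > 0`, `1 - (1 - e^{-x})/x ≤ x` (from `e^{-x} ≤ (1+x)⁻¹ ≤ 1 - x + x²`). [folklore] -/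
theorem kClosed_le_self {x : ℝ} (hx : 0 < x) : 1 - (1 - Real.exp (-x)) / x ≤ x := by
  have hE : Real.exp (-x) ≤ 1 - x + x ^ 2 := by
    have h1 : x + 1 ≤ Real.exp x := Real.add_one_le_exp x
    have h2 : Real.exp (-x) ≤ 1 / (x + 1) := by
      rw [Real.exp_neg, ← one_div]
      exact one_div_le_one_div_of_le (by linarith) h1
    have h3 : 1 / (x + 1) ≤ 1 - x + x ^ 2 := by
      rw [div_le_iff₀ (by linarith)]
      nlinarith [sq_nonneg x, hx.le]
    exact h2.trans h3
  have h4 : 1 - x ≤ (1 - Real.exp (-x)) / x := by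
    rw [le_div_iff₀ hx]
    nlinarith
  linarith

/-- Elementary: for `x > 0`, `1 - 1/x ≤ 1 - (1 - e^{-x})/x ≤ 1`. [folklore] -/
theorem kClosed_ge_and_le_one {x : ℝ} (hx : 0 < x) :
    1 - x⁻¹ ≤ 1 - (1 - Real.exp (-x)) / x ∧ 1 - (1 - Real.exp (-x)) / x ≤ 1 := by
  have hpos : 0 < Real.exp (-x) := Real.exp_pos _
  have hle : Real.exp (-x) ≤ 1 := by
    rw [Real.exp_le_one_iff]; linarith
  constructor
  · have : (1 - Real.exp (-x)) / x ≤ x⁻¹ := by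
      rw [div_le_iff₀ hx, inv_mul_cancel₀ hx.ne']
      linarith
    linarith
  · have : 0 ≤ (1 - Real.exp (-x)) / x := div_nonneg (by linarith) hx.le
    linarith

/-- `0 ≤ k_{C_λ}(τ) ≤ λτ` for `λ, τ > 0`. [folklore] -/
theorem gkWindow_expCov_bounds {lam τ : ℝ} (hlam : 0 < lam) (hτ : 0 < τ) :
    0 ≤ gkWindow (expCov lam) τ ∧ gkWindow (expCov lam) τ ≤ lam * τ := by
  rw [gkWindow_expCov hlam.ne' hτ.ne']
  exact ⟨kClosed_nonneg (mul_pos hlam hτ), kClosed_le_self (mul_pos hlam hτ)⟩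

/-- **Green–Kubo limit of the toy current: `k_{C_λ}(τ) → 1` as `τ → ∞`, for every rate `λ > 0`.**
[folklore] -/
theorem tendsto_gkWindow_expCov {lam : ℝ} (hlam : 0 < lam) :
    Tendsto (gkWindow (expCov lam)) atTop (𝓝 1) := by
  have hlow : Tendsto (fun τ : ℝ => 1 - (lam * τ)⁻¹) atTop (𝓝 1) := by
    have h : Tendsto (fun τ : ℝ => (lam * τ)⁻¹) atTop (𝓝 0) :=
      tendsto_inv_atTop_zero.comp (Tendsto.const_mul_atTop hlam tendsto_id)
    simpa using (tendsto_const_nhds (x := (1 : ℝ))).sub h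
  refine tendsto_of_tendsto_of_tendsto_of_le_of_le' hlow tendsto_const_nhds ?_ ?_
  · filter_upwards [eventually_gt_atTop 0] with τ hτ
    rw [gkWindow_expCov hlam.ne' hτ.ne']
    exact (kClosed_ge_and_le_one (mul_pos hlam hτ)).1
  · filter_upwards [eventually_gt_atTop 0] with τ hτ
    rw [gkWindow_expCov hlam.ne' hτ.ne']
    exact (kClosed_ge_and_le_one (mul_pos hlam hτ)).2

/-- A uniform bound on the autocovariance bounds the window functional linearly in the window:
`|C| ≤ B` on `[0, ∞)` gives `|k_C(τ)| ≤ 2Bτ` for `τ > 0`. [folklore] -/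
theorem abs_gkWindow_le {C : ℝ → ℝ} {B τ : ℝ} (hC : ∀ s, 0 ≤ s → |C s| ≤ B) (hτ : 0 < τ) :
    |gkWindow C τ| ≤ 2 * B * τ := by
  have hB : 0 ≤ B := (abs_nonneg _).trans (hC 0 le_rfl)
  have hint : ‖∫ s in (0 : ℝ)..τ, (τ - s) * C s‖ ≤ τ * B * |τ - 0| := by
    refine intervalIntegral.norm_integral_le_of_norm_le_const fun s hs => ?_
    rw [Set.uIoc_of_le hτ.le] at hs
    rw [Real.norm_eq_abs, abs_mul]
    have h1 : |τ - s| ≤ τ := by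
      rw [abs_of_nonneg (by linarith [hs.2])]
      linarith [hs.1]
    exact mul_le_mul h1 (hC s hs.1.le) (abs_nonneg _) hτ.le
  rw [sub_zero, abs_of_pos hτ, Real.norm_eq_abs] at hint
  unfold gkWindow
  rw [abs_mul, abs_div, abs_of_pos hτ, abs_two]
  calc 2 / τ * |∫ s in (0 : ℝ)..τ, (τ - s) * C s| ≤ 2 / τ * (τ * B * τ) := by
        gcongr
    _ = 2 * B * τ := by field_simp

/-- **Schema: every family of current autocovariances that is uniformly super-polynomially small
passes Theorem 2's test at every pair of orders, whatever its Green–Kubo integral.** If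
`|C_ε(s)| ≤ B(ε)` for `s ≥ 0` and `ε^{-k}B(ε) → 0` (`ε → 0⁺`) for every `k`, then
`lim_{t→∞} limsup_{ε→0⁺} ε^{-m}|k_{C_ε}(ε^{-n}t)| = 0` for all `m, n`. [folklore] -/
theorem polyWindow_vanishing_of_supSmall {C : ℝ → ℝ → ℝ} {B : ℝ → ℝ}
    (hCB : ∀ ε s, 0 < ε → 0 ≤ s → |C ε s| ≤ B ε)
    (hB : ∀ k : ℕ, Tendsto (fun ε : ℝ => ε ^ (-(k : ℝ)) * B ε) (𝓝[>] 0) (𝓝 0)) (m n : ℕ) :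
    Tendsto
      (fun t : ℝ =>
        limsup (fun ε : ℝ => ENNReal.ofReal (ε ^ (-(m : ℝ)) * |gkWindow (C ε) (ε ^ (-(n : ℝ)) * t)|))
          (𝓝[>] 0))
      atTop (𝓝 0) := by
  refine (tendsto_const_nhds (x := (0 : ℝ≥0∞))).congr' ?_
  filter_upwards [eventually_gt_atTop 0] with t ht
  have hup : Tendsto (fun ε : ℝ => 2 * t * (ε ^ (-((m + n : ℕ) : ℝ)) * B ε)) (𝓝[>] 0) (𝓝 0) := by
    simpa using (hB (m + n)).const_mul (2 * t)
  have hreal : Tendsto (fun ε : ℝ => ε ^ (-(m : ℝ)) * |gkWindow (C ε) (ε ^ (-(n : ℝ)) * t)|)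
      (𝓝[>] 0) (𝓝 0) := by
    refine tendsto_of_tendsto_of_tendsto_of_le_of_le' tendsto_const_nhds hup ?_ ?_
    · filter_upwards [self_mem_nhdsWithin] with ε (hε : 0 < ε)
      exact mul_nonneg (Real.rpow_nonneg hε.le _) (abs_nonneg _)
    · filter_upwards [self_mem_nhdsWithin] with ε (hε : 0 < ε)
      have hτ : 0 < ε ^ (-(n : ℝ)) * t := mul_pos (Real.rpow_pos_of_pos hε _) ht
      have hb := abs_gkWindow_le (fun s hs => hCB ε s hε hs) hτ
      have hm : 0 ≤ ε ^ (-(m : ℝ)) := Real.rpow_nonneg hε.le _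
      calc ε ^ (-(m : ℝ)) * |gkWindow (C ε) (ε ^ (-(n : ℝ)) * t)|
          ≤ ε ^ (-(m : ℝ)) * (2 * B ε * (ε ^ (-(n : ℝ)) * t)) := mul_le_mul_of_nonneg_left hb hm
        _ = 2 * t * (ε ^ (-((m + n : ℕ) : ℝ)) * B ε) := by
            rw [Nat.cast_add, neg_add, Real.rpow_add hε]
            ring
  have h := ENNReal.tendsto_ofReal hreal
  rw [ENNReal.ofReal_zero] at h
  exact h.limsup_eq.symm

/-- `ε^{-m-n} e^{-1/ε} → 0` as `ε → 0⁺`. [folklore] -/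
theorem tendsto_rpow_neg_mul_slowRate (k : ℕ) :
    Tendsto (fun ε : ℝ => ε ^ (-(k : ℝ)) * slowRate ε) (𝓝[>] 0) (𝓝 0) := by
  have h := (Real.tendsto_pow_mul_exp_neg_atTop_nhds_zero k).comp tendsto_inv_nhdsGT_zero
  refine h.congr' ?_
  filter_upwards [self_mem_nhdsWithin] with ε (hε : 0 < ε)
  simp only [Function.comp_apply, slowRate]
  rw [Real.rpow_neg hε.le, Real.rpow_natCast, inv_pow]

/-- The slow exponential family is uniformly super-polynomially small:
`|C_ε(s)| ≤ λ_ε/2` for `s ≥ 0`. [folklore] -/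
theorem abs_expCov_slowRate_le (ε s : ℝ) (hs : 0 ≤ s) :
    |expCov (slowRate ε) s| ≤ slowRate ε / 2 := by
  have hl := slowRate_pos ε
  unfold expCov
  rw [abs_of_nonneg (by positivity)]
  have : Real.exp (-(slowRate ε * s)) ≤ 1 := by
    rw [Real.exp_le_one_iff]
    nlinarith
  nlinarith

/-- … and `ε^{-k} λ_ε/2 → 0`. [folklore] -/
theorem tendsto_rpow_neg_mul_slowRate_half (k : ℕ) :
    Tendsto (fun ε : ℝ => ε ^ (-(k : ℝ)) * (slowRate ε / 2)) (𝓝[>] 0) (𝓝 0) := by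
  simpa [mul_div_assoc] using (tendsto_rpow_neg_mul_slowRate k).div_const 2

/-- **Theorem 2's triple limit holds for the slow exponential family at EVERY pair of orders
`(m, n)`** (instance of `polyWindow_vanishing_of_supSmall`; here `k ≥ 0`, so no absolute value is
needed). [folklore] -/
theorem polyWindow_vanishing (m n : ℕ) :
    Tendsto
      (fun t : ℝ =>
        limsup (fun ε : ℝ =>
          ENNReal.ofReal (ε ^ (-(m : ℝ)) * gkWindow (expCov (slowRate ε)) (ε ^ (-(n : ℝ)) * t)))
          (𝓝[>] 0))
      atTop (𝓝 0) := by
  have h := polyWindow_vanishing_of_supSmall (C := fun ε => expCov (slowRate ε))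
    (B := fun ε => slowRate ε / 2) (fun ε s _ hs => abs_expCov_slowRate_le ε s hs)
    tendsto_rpow_neg_mul_slowRate_half m n
  refine h.congr' ?_
  filter_upwards [eventually_gt_atTop 0] with t ht
  refine limsup_congr ?_
  filter_upwards [self_mem_nhdsWithin] with ε (hε : 0 < ε)
  have hτ : 0 < ε ^ (-(n : ℝ)) * t := mul_pos (Real.rpow_pos_of_pos hε _) ht
  rw [abs_of_nonneg (gkWindow_expCov_bounds (slowRate_pos ε) hτ).1]

end HeatConduction.OUCurrent

open HeatConduction.OUCurrent

/-- **NARROWED BARRIER `AnticontinuumLocalizationNarrow` (barrier audit of `AnticontinuumLocalization` = `DeRoeckHuveneers2015_thm2`, 2026-08-15).** Five conjuncts, all proved (`AnticontinuumLocalizationNarrow_holds`). (1) TRUST BASE: `DeRoeckHuveneers2015_thm1 → DeRoeckHuveneers2015_thm2` — the catalogued fact is the printed §7 consequence of Theorem 1 alone (stationarity and (7.1) are proved in the tree), so what is ESTABLISHED is exactly: for the rotor chain, after `N → ∞`, on every window `[0, ε^{-n}t]` the finite-time Green–Kubo functional is `o(ε^m)` for `m < n` (and interval energies are frozen in `L²(Gibbs)`,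 Theorem 4). (2) SCHEMA (the gap): for the window functional `k_C(τ) = (2/τ)∫₀^τ(τ-s)C(s)ds` (`= τ⁻¹Var∫₀^τJ` for a stationary current with autocovariance `C`; the quantity of Theorem 2 at `N = ∞`), EVERY family of autocovariances with `sup_{s≥0}|C_ε(s)| ≤ B(ε) = O(ε^∞)` satisfies Theorem 2's conclusion `lim_{t→∞} limsup_{ε→0⁺} ε^{-m}|k_{C_ε}(ε^{-n}t)| = 0` for ALL `m, n` — whatever `2∫₀^∞C_ε` is. (3)–(5) INSTANCE: the Ornstein–Uhlenbeck autocovariances `C_ε(s) = (λ_ε/2)e^{-λ_εs}`, `λ_ε = e^{-1/ε}`, satisfy the schema's two hypotheses and have `lim_{τ→∞} k_{C_ε}(τ) = 1` for every `ε`. Hence statements of Theorem 2's shape, at any orders, imply nothing about `lim_τ` — not `κ = O(ε^m)`, not `κ → 0`, not `κ < 1`.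
BARRIER (D-0021), AtomisticToContinuum/FouriersLaw (narrowing of the block on `DeRoeckHuveneers2015_thm2`):
technique_class: polynomial-window transport certificates at weak coupling — arguments that would establish transport, relaxation or a conductivity lower bound for the rotor chain (2.1) (pinning `εγ(1 - cos q_x)` scaled WITH `ε`) or the DNLS chain (2.3), `d = 1`, from the dynamics on time windows `[0, ε^{-n}t]` for some fixed `n`, in `L²` of the Gibbs state, as `ε → 0` after `N → ∞`: weak-coupling scaling limits (`ε → 0` with `t ∼ ε^{-2}` or `ε^{-n}`, then hydrodynamics), finite-order expansions in `ε` of the dynamics / current correlations evaluated on such windows (naive Taylor–Dyson or resummed KAM normal forms), Nekhoroshev-window energy-exchange estimates [cite: DeRoeckHuveneers2015, §2.3 Thms 2 and 4]; NOT covered, although inside the catalogued wording "anti-continuum / weak-coupling expansions `κ = ∑ κ_k ε^k`": expansions, asymptotics or lower bounds of the INFINITE-time conductivity `κ(T, ε)` (`t → ∞` before `ε → 0`) — conjuncts (2)–(5).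
blocks: (a) reading positivity, or a lower bound `≥ cε^m`, of the conductivity of THESE chains off a polynomial time window: there the finite-time Green–Kubo functional is `o(ε^m)` for every `m < n` [cite: DeRoeckHuveneers2015, §2.3 Thm 2] and interval energies move by `O(ε^{1/8})` in `L²(Gibbs)` up to `t = ε^{-n}` [cite: DeRoeckHuveneers2015, §2.3 Thm 4]; in particular the weak-coupling-limit step of the Liverani–Olla / Dolgopyat–Liverani programme (`ε → 0`, `t ε^{-2}`) has a TRIVIAL limit for these one-degree-of-freedom integrable cells — "these scaling limits are trivial in the sense that we do not see any transport on the time scales that we study" [cite: DeRoeckHuveneers2015, §2.3 before Thm 2]; (b) a literal power law `t₀ ∼ g^{-p}` for the `L²(Gibbs)` relaxation time of site or interval energies, for `ε` below the threshold `ε₀(n)` of Theorem 4 with `n > p` — the numerically fitted `t₀(g) ∼ g^{-5}` and `g^{-6.5}` "would actually contradict … the non-perturbative nature of transport. However, since the bounds on the perturbative contributions to transport are actually mathematically rigorous … we think that what is at play here is the numerical difficulty of distinguishing a high power from a superpolynomial function" [cite: DeRoeckHuveneers2019, §2]. It does NOT block: positivity of the infinite-time `κ_GK(T, ε)` of these chains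 at fixed `ε` by an argument that is not a polynomial-window certificate — nor even an `ε`-power-law LOWER bound on it (conjuncts (2)–(5): compatible with every finite-window statement of the source) — and nothing about `OscillatorChain.FouriersLawFor (pinnedChain ω₂ lam β γ)` of the conjunct, which is weakly coupled in no parameter regime (coupling `r²/2 + βr⁴/4`, unit harmonic part).
because: conjunct (1) is the printed proof of Theorem 2 [cite: DeRoeckHuveneers2015, §7] with its two imported inputs discharged (`GibbsStationarity_holds`, `DeRoeckHuveneers2015_decorrelation_holds`); conjunct (2): `|k_C(τ)| ≤ 2Bτ` when `|C| ≤ B` (`abs_gkWindow_le`), so `ε^{-m}|k_{C_ε}(ε^{-n}t)| ≤ 2t ε^{-m-n}B(ε) → 0`; conjuncts (3)–(5): `|C_ε| ≤ λ_ε/2`, `ε^{-k}e^{-1/ε} → 0`, and `k_{C_λ}(τ) = 1 - (1 - e^{-λτ})/(λτ) ∈ [1 - (λτ)⁻¹, 1]` (`gkWindow_expCov`); physically: the theorems control the current's time integral only up to `ε^{-n}t`, and `τ ↦ τ⁻¹Var∫₀^τJ` is neither monotone nor otherwise controlled beyond (Theorem 1 leaves `ε^{n+1}∫₀^τ G_a(X^s)ds`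 with no `τ`-uniform bound) — in the source's words, "one would need to exchange the limits `t → ∞` and `ε → 0`", "One could speculate whether some non-perturbative effects could lead to a breakdown of the conjecture `κ(T, ε) = O(ε^m)`. We cannot exclude this", "We would find it very interesting to push the analysis to longer time scales and to exhibit a non-vanishing contribution to the conductivity" [cite: DeRoeckHuveneers2015, §2.3]; the expected carrier of transport is rare MOBILE chaotic spots (resonant triples, Gibbs probability `∼ βg`) hopping at the super-polynomially small rate `γ ∼ g^{1/2}e^{-c(log βg)²}` [cite: DeRoeckHuveneers2019, §2], which yields the heuristic LOWER bound `κ(T) ∼ g exp(-C(log(√(UT)/J))²)` — positive and invisible on every polynomial window [cite: Huveneers2017, §2.3].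
evasions_known: (i) none rigorous for the deterministic rotor / DNLS chains — `κ(T, ε) < ∞` and `κ(T, ε) > 0` are both open ("we do not even rigorously know whether the chains we consider are normal conductors") [cite: DeRoeckHuveneers2015, §2.3 after Thm 2]; (ii) NOISE: with an energy-conserving noise of FIXED intensity `λ > 0` on the cells, the formal weak-coupling expansion `κ(ε, λ) = ε² ∑_{n≥2} ε^{n-2} κ_n(λ)` has a well-defined second-order coefficient which, for the rotor chain, is "strictly positive" with `limsup_{λ→0} κ₂(λ) < +∞` (Prop. 8.6, lower bound `β⁻²κ₂(λ) ≥ cλ`), while "We have unfortunately not been able to decide whether … `κ₂(λ)` still vanishes as `λ → 0`" [cite: BernardinHuveneersLebowitzLiveraniOlla2015, §8 and §8.3 Prop. 8.6 (arXiv numbering)] — so the second-order "no transport" statement is open in the zero-noise limit of the noisy expansion; with noise of intensity `ε^{n+1}` the conductivity is finite and `≤ C_nεⁿ` [cite: DeRoeckHuveneers2015, §2.3 Thm 3]; (iii) CHAOTIC or noisy multi-dimensional cells (Dolgopyat–Liverani, Liverani–Olla, Lukkarinen–Spohn) have NON-trivial weak-coupling limits at `t ∼ ε^{-2}` — a change of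 model, unavailable for one-degree-of-freedom cells [cite: DeRoeckHuveneers2015, §2.3 before Thm 2]; (iv) A PRIORI UNSTABLE lattices: for penduli with `O(1)` gravity (`E_j = p_j²/2 + cos q_j - 1`, pinning NOT scaled with `ε`) on `ℤ^m` and suitable `C⁴` next-to-nearest-neighbour couplings `εH₁`, for all small `ε` there are orbits transferring a prescribed energy `h` along any prescribed lattice path [cite: GiulianiGuardia2023, Thm 1.1] (variational version with time estimates on periodic lattices: Kaloshin–Levi–Saprykina, reported ibid. §1.3) — measure-zero constructions with chosen perturbations, no conductivity statement; for a priori STABLE lattices "(for instance a weakly coupled sequence of rotators …) Constructing Arnold diffusion orbits in such models is an outstanding open problem" [cite: GiulianiGuardia2023, §1 before §1.1]; (v) SUPER-POLYNOMIAL times are untouched by every theorem of the source, and delocalization there is the authors' own conjecture: "we conjecture that, here as well, localization does not persist on longer times than [`e^{-c ln³(1/ε)}`] … we do not think that one can obtain Nekhoroshev estimates in infinite volume for times as long as those in finite volume" [cite: DeRoeckHuveneers2015, §2.4 "How optimal are our bounds?"].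
scope_caveats: (a) conjuncts (2)–(5) are about autocovariance functions, not about the rotor chain: they show that the SHAPE of Theorem 2 carries no information on `lim_{τ→∞}`, not that the rotor chain conducts; the identification `k_C(τ) = τ⁻¹Var∫₀^τJ` is folklore and only its integration-by-parts form is proved here (`gkWindow_eq_cesaro`); (b) every caveat of the catalogued entry stands (rotor (2.1) / DNLS (2.3) only, `d = 1`, Gibbs-`L²`, `N → ∞` before `ε → 0`; quartic chain (2.12) open; `κ` versus `κ_GK`; `pinnedChain` never anti-continuum); (c) NAIVE fixed-time perturbation theory DOES see transport at second order: for the rotor chain at `ε = 0` (free rotation, product Gibbs state) `lim_{τ→∞} τ⁻¹T⁻²⟨(∫₀^τ 𝒥_N∘X₀^s ds)²⟩ → (√π/4)T^{-3/2}` per unit length as `N → ∞` (free resonant streaming, `π E[ω₁²δ(ω₀ - ω₁)]/T²`; a computation of the audit notes, NOT formalised), which first-order resonances cage on times `∼ ε^{-1/2}` (the resonant pair is a pendulum) — "every order sees no transport" is a statement about the RESUMMED expansion on windows `ε^{-n}t`, `n > m`, not about Taylor coefficients at fixed time, and Theorem 2 says nothing for `n ≤ m`; (d) Theorem 1 (the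 KAM-type decomposition, §§3–6) remains a named fact of the main file — the audit did not re-derive it; (e) evasions (ii)–(iv) change the model (noise, chaotic cells, `O(1)` pinning with designed couplings) and none yields `κ > 0` for a deterministic chain.
status: established (all five conjuncts proved in this file)
[cite: DeRoeckHuveneers2015, §2.3 Thms 1, 2, 4 and §2.4] [cite: DeRoeckHuveneers2019, §2] [cite: Huveneers2017, §2.3] [cite: BernardinHuveneersLebowitzLiveraniOlla2015, §8.3 Prop. 8.6] [cite: GiulianiGuardia2023, Thm 1.1] -/
def AnticontinuumLocalizationNarrow : Prop :=
  (DeRoeckHuveneers2015_thm1 → DeRoeckHuveneers2015_thm2) ∧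
    (∀ (C : ℝ → ℝ → ℝ) (B : ℝ → ℝ),
      (∀ ε s, 0 < ε → 0 ≤ s → |C ε s| ≤ B ε) →
      (∀ k : ℕ, Tendsto (fun ε : ℝ => ε ^ (-(k : ℝ)) * B ε) (𝓝[>] 0) (𝓝 0)) →
      ∀ m n : ℕ,
        Tendsto
          (fun t : ℝ =>
            limsup (fun ε : ℝ =>
              ENNReal.ofReal (ε ^ (-(m : ℝ)) * |gkWindow (C ε) (ε ^ (-(n : ℝ)) * t)|))
              (𝓝[>] 0))
          atTop (𝓝 0)) ∧
    (∀ ε s : ℝ, 0 ≤ s → |expCov (slowRate ε) s| ≤ slowRate ε / 2) ∧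
    (∀ k : ℕ, Tendsto (fun ε : ℝ => ε ^ (-(k : ℝ)) * (slowRate ε / 2)) (𝓝[>] 0) (𝓝 0)) ∧
    ∀ ε : ℝ, Tendsto (gkWindow (expCov (slowRate ε))) atTop (𝓝 1)

/-- **Proof of the narrowed barrier.** [folklore] -/
theorem AnticontinuumLocalizationNarrow_holds : AnticontinuumLocalizationNarrow :=
  ⟨DeRoeckHuveneers2015_thm2_of_thm1_alone,
    fun _C _B hCB hB m n => polyWindow_vanishing_of_supSmall hCB hB m n,
    abs_expCov_slowRate_le, tendsto_rpow_neg_mul_slowRate_half,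
    fun ε => tendsto_gkWindow_expCov (slowRate_pos ε)⟩

/-- The catalogued barrier fact from the narrowed one and Theorem 1. [folklore] -/
theorem DeRoeckHuveneers2015_thm2_of_narrow (h : AnticontinuumLocalizationNarrow)
    (h1 : DeRoeckHuveneers2015_thm1) : DeRoeckHuveneers2015_thm2 :=
  h.1 h1

end Literature.Barriers.AtomisticToContinuum

end
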